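import Summits.ValiantsHypothesis.ValiantsHypothesis.Theorems.LacunarySymmetroidMatrixDescartesPivotRankOneFourKillSeven
import Summits.ValiantsHypothesis.ValiantsHypothesis.Theorems.LacunarySymmetroidMatrixDescartesCensusCircuitRow

/-!
# `MatrixDescartes` census — rank-one `(2,4)₁` in chamber (B): `Z₊ ≤ 8` by KILL-EIGHT + the CIRCUIT TRINOMIAL
# (WEIGHT-DEPENDENT conditions (C₀), (C₁), (C_J): a letter weakly core, or `|det J|` small, relative to its two neighbours)

HONEST FRAMING.  Object-search cell `pub-symmetroid`, seat `val-sym-mdr-p1` (generation 14); helper file `--supports` the crux item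
stmt-ValiantsHypothesis-18050 (`Theses.LacunarySymmetroid.MatrixDescartes`, OPEN, on HOLD) with NO closure claim.  The rank-one law
«`(2,4)₁ ≤ 8`» is open exactly in the interleaving chambers (A), (B) of the split `d₀ < d₁ < e < d₂ < d₃` (and (C), (C′) of the one/three
splits).  In chamber (B) — degree order `d₀+d₁ < e+d₀ < d₀+d₂ < e+d₁ < d₁+d₂ < 2e < d₀+d₃ < e+d₂ < d₁+d₃ < e+d₃ < d₂+d₃` — every one of
the five NEGATIVE degrees (`e+dₖ` with coefficient `wₖ m(J,vₖ)`, `2e` with coefficient `det J`) sits between two POSITIVE pair degrees.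
The generation-12/13 kill-seven theorems (`…PivotRankOneFourKillSeven{,Prime,Pairs,Bottom}`, engine `card_posRoots_le_kills` +
`card_posRoots_fourNomial_le_one`) give `Z₊ ≤ 8` under WEIGHT-FREE conditions, and generation 13 showed (memo GAPS-AND-WINDOWS §3) that
weight-free conditions cannot cover chamber (B): they all fail when a letter approaches the core boundary while the angular spread is
large — «the covering must now involve the weights».  THIS FILE lands the complementary, WEIGHT-DEPENDENT family: kill the EIGHT degrees
other than a consecutive triple `(pair, negative, pair)`; the eight kills preserve the sign pattern `+ − +` (every killed degree lies on
the same side of all three survivors or the parities agree), and the surviving trinomial `α X^r − β X^{r+p} + γ X^{r+p+q}` has NO positive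
root when `β` is below the CIRCUIT NUMBER, `β^{p+q} q^q p^p < (p+q)^{p+q} α^q γ^p` (weighted AM–GM; tree
`Census.countP_posRoots_trinomial_eq_zero_of_circuit`, `…CensusCircuitRow`), whence `Z₊ ≤ 8 + 0`:

* **(C₀)** triple `(d₀+d₁, e+d₀, d₀+d₂)`: `β = w₀|m₀|·Π₀`, `α = w₀w₁Δ₀₁²·Π₀₁`, `γ = w₀w₂Δ₀₂²·Π₀₂`, `p = e−d₁`, `q = d₂−e`
  (`elevenNomial_chamberB_C0_le_eight`, matrix form `rankOne_posRoots_le_eight_of_C0`; exponent hypothesis `d₀+d₂ < e+d₁` only) —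
  holds when letter `0` is WEAKLY CORE (`|m₀|` small against `w₁^{q}w₂^{p}`-weighted chords), in particular near the core boundary
  and for every fixed direction data once `w₁, w₂` are large;
* **(C₁)** triple `(d₀+d₂, e+d₁, d₁+d₂)`: `β = w₁|m₁|·Π`, `α = w₀w₂Δ₀₂²·Π`, `γ = w₁w₂Δ₁₂²·Π`, `p = e+d₁−d₀−d₂`, `q = d₂−e`
  (`…_C1_…`; hypotheses `d₀+d₂ < e+d₁`, `d₁+d₂ < 2e < d₀+d₃`) — letter `1` weakly core, or `w₁` SMALL (β ∝ w₁, γ ∝ w₁, α free of w₁);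
* **(C_J)** triple `(d₁+d₂, 2e, d₀+d₃)`: `β = |det J|·Π`, `α = w₁w₂Δ₁₂²·Π`, `γ = w₀w₃Δ₀₃²·Π`, `p = 2e−d₁−d₂`, `q = d₀+d₃−2e`
  (`…_CJ_…`; hypotheses `d₁+d₂ < 2e < d₀+d₃ < e+d₂`) — the pivot weakly indefinite against the letters.

The `Π`'s are the products of the distances from the surviving degree to the eight killed degrees (factor by factor, each positive
under the stated hypotheses).  `det J` and the pairings `mₖ` are otherwise ARBITRARY (for `β ≤ 0` the conclusion is Descartes' anyway);
the companion file `…PivotRankOneFourKillEightTop` treats the triples around `e+d₂` and `e+d₃`.  LOCATED remark (seat memo): the five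
circuit conditions are exactly the «near-boundary» complements of the weight-free kill-seven conditions; whether the union covers
chamber (B) is NOT claimed here.  Nothing in this file bears on `MatrixDescartes` in its window, on `DoorA26` / `DoorA34`, registers /
credences, or `VP ≠ VNP`.

[folklore] Weighted Rolle (tree engine) and the circuit number of a trinomial [cite: IlimanDewolff2016, Theorem 3.8 (n = 1)] via the
tree lemma; `2 × 2` determinant algebra.  No definitions, no named facts.
-/

-- `Summit.ValiantsHypothesis.ValiantsHypothesis.…` repeats a component by the D-0017 layout
-- (single-conjunct summit), which the `dupNamespace` linter flags; the name is mandated.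
set_option linter.dupNamespace false

namespace Summit.ValiantsHypothesis.ValiantsHypothesis.Theorems.LacunarySymmetroidMatrixDescartes.Pivot.TwoDirections.BlockLaw

open Polynomial Matrix Finset
open scoped BigOperators

/-! ## 0. The terminal lemma in `Finset` currency -/

/-- A trinomial `α X^r − β X^{r+p} + γ X^{r+p+q}` (`α, γ > 0`, `p, q > 0`) with `β` below the circuit number (or `β ≤ 0`) has no
positive root: the `roots.toFinset` form of the tree's `Census.countP_posRoots_trinomial_eq_zero_of_circuit`.
[cite: IlimanDewolff2016, Theorem 3.8 (n = 1)] -/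
theorem card_posRoots_trinomial_eq_zero_of_circuit (α β γ : ℝ) (r p q : ℕ) (hα : 0 < α) (hγ : 0 < γ) (hp : 0 < p)
    (hq : 0 < q)
    (hcirc : β ≤ 0 ∨ β ^ (p + q) * ((q : ℝ) ^ q * (p : ℝ) ^ p) < ((p + q : ℕ) : ℝ) ^ (p + q) * (α ^ q * γ ^ p)) :
    ((Polynomial.C α * X ^ r - Polynomial.C β * X ^ (r + p) + Polynomial.C γ * X ^ (r + p + q)).roots.toFinset.filter
        (fun t => 0 < t)).card = 0 := by
  classical
  have h := Census.countP_posRoots_trinomial_eq_zero_of_circuit α β γ r p q hα hγ hp hq hcirc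
  rw [Multiset.countP_eq_zero] at h
  rw [Finset.card_eq_zero, Finset.filter_eq_empty_iff]
  intro x hx
  exact h x (Multiset.mem_toFinset.1 hx)

/-! ## 1. (C₀): the bottom letter weakly core -/

/-- **(C₀), real-parameter form.**  The chamber-(B) eleven-nomial (exponent hypotheses `d₀+d₂ < e+d₁` beyond the split; all coefficient data
arbitrary except the positivity of the two surviving pair coefficients) has at most EIGHT positive roots when the killed negative term of
letter `0` (the bottom letter) is below the circuit number of its two killed neighbours. -/
theorem elevenNomial_chamberB_C0_le_eight (e d₀ d₁ d₂ d₃ : ℕ) (h01 : d₀ < d₁) (h1e : d₁ < e) (he2 : e < d₂) (h23 : d₂ < d₃)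
    (hB1 : d₀ + d₂ < e + d₁)
    (dJ m₀ m₁ m₂ m₃ w₀ w₁ w₂ w₃ D01 D02 D03 D12 D13 D23 : ℝ) (hw₀ : 0 < w₀) (hw₁ : 0 < w₁) (hw₂ : 0 < w₂) (hD01 : 0 < D01) (hD02 : 0 < D02)
    (hcirc : (w₀ * (-m₀)
        * (((e : ℝ) - d₀) * ((d₁ : ℝ) - d₀) * ((d₂ : ℝ) - d₀) * ((d₃ : ℝ) - d₀) * ((d₃ : ℝ) - e) * ((d₁ : ℝ) + d₂ - e - d₀) * ((d₁ : ℝ) + d₃ - e - d₀) * ((d₂ : ℝ) + d₃ - e - d₀))) ^ (e - d₁ + (d₂ - e)) * ((((d₂ - e : ℕ) : ℝ)) ^ (d₂ - e) * (((e - d₁ : ℕ) : ℝ)) ^ (e - d₁))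
      < (((e - d₁ + (d₂ - e) : ℕ) : ℝ)) ^ (e - d₁ + (d₂ - e))
        * ((w₀ * w₁ * D01
          * (((2 : ℝ) * e - d₀ - d₁) * ((e : ℝ) - d₀) * ((e : ℝ) + d₂ - d₀ - d₁) * ((e : ℝ) + d₃ - d₀ - d₁) * ((d₃ : ℝ) - d₁) * ((d₂ : ℝ) - d₀) * ((d₃ : ℝ) - d₀) * ((d₂ : ℝ) + d₃ - d₀ - d₁))) ^ (d₂ - e)
          * (w₀ * w₂ * D02
          * (((2 : ℝ) * e - d₀ - d₂) * ((e : ℝ) + d₁ - d₀ - d₂) * ((e : ℝ) - d₀) * ((e : ℝ) + d₃ - d₀ - d₂) * ((d₃ : ℝ) - d₂) * ((d₁ : ℝ) - d₀) * ((d₁ : ℝ) + d₃ - d₀ - d₂) * ((d₃ : ℝ) - d₀))) ^ (e - d₁))) :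
    ((∑ i : Fin 11, Polynomial.C ((![dJ, w₀ * m₀, w₁ * m₁, w₂ * m₂, w₃ * m₃, w₀ * w₁ * D01, w₀ * w₂ * D02, w₀ * w₃ * D03, w₁ * w₂ * D12, w₁ * w₃ * D13, w₂ * w₃ * D23] : Fin 11 → ℝ) i) * X ^ ((![2 * e, e + d₀, e + d₁, e + d₂, e + d₃, d₀ + d₁, d₀ + d₂, d₀ + d₃, d₁ + d₂, d₁ + d₃, d₂ + d₃] : Fin 11 → ℕ) i)).roots.toFinset.filter (fun t => 0 < t)).card ≤ 8 := by
  classical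
  have h01' : (d₀ : ℝ) < d₁ := by exact_mod_cast h01
  have h1e' : (d₁ : ℝ) < e := by exact_mod_cast h1e
  have he2' : (e : ℝ) < d₂ := by exact_mod_cast he2
  have h23' : (d₂ : ℝ) < d₃ := by exact_mod_cast h23
  have hB1' : (d₀ : ℝ) + d₂ < e + d₁ := by exact_mod_cast hB1
  -- the three distance products
  obtain ⟨PA, hPA⟩ : ∃ x : ℝ, x = ((2 : ℝ) * e - d₀ - d₁) * ((e : ℝ) - d₀) * ((e : ℝ) + d₂ - d₀ - d₁) * ((e : ℝ) + d₃ - d₀ - d₁) * ((d₃ : ℝ) - d₁) * ((d₂ : ℝ) - d₀) * ((d₃ : ℝ) - d₀) * ((d₂ : ℝ) + d₃ - d₀ - d₁) := ⟨_, rfl⟩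
  obtain ⟨PB, hPB⟩ : ∃ x : ℝ, x = ((e : ℝ) - d₀) * ((d₁ : ℝ) - d₀) * ((d₂ : ℝ) - d₀) * ((d₃ : ℝ) - d₀) * ((d₃ : ℝ) - e) * ((d₁ : ℝ) + d₂ - e - d₀) * ((d₁ : ℝ) + d₃ - e - d₀) * ((d₂ : ℝ) + d₃ - e - d₀) := ⟨_, rfl⟩
  obtain ⟨PC, hPC⟩ : ∃ x : ℝ, x = ((2 : ℝ) * e - d₀ - d₂) * ((e : ℝ) + d₁ - d₀ - d₂) * ((e : ℝ) - d₀) * ((e : ℝ) + d₃ - d₀ - d₂) * ((d₃ : ℝ) - d₂) * ((d₁ : ℝ) - d₀) * ((d₁ : ℝ) + d₃ - d₀ - d₂) * ((d₃ : ℝ) - d₀) := ⟨_, rfl⟩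
  have hPAp : 0 < PA := by
    rw [hPA]
    have f1 : 0 < ((2 : ℝ) * e - d₀ - d₁) := by linarith
    have f2 : 0 < ((e : ℝ) - d₀) := by linarith
    have f3 : 0 < ((e : ℝ) + d₂ - d₀ - d₁) := by linarith
    have f4 : 0 < ((e : ℝ) + d₃ - d₀ - d₁) := by linarith
    have f5 : 0 < ((d₃ : ℝ) - d₁) := by linarith
    have f6 : 0 < ((d₂ : ℝ) - d₀) := by linarith
    have f7 : 0 < ((d₃ : ℝ) - d₀) := by linarith
    have f8 : 0 < ((d₂ : ℝ) + d₃ - d₀ - d₁) := by linarith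
    exact mul_pos (mul_pos (mul_pos (mul_pos (mul_pos (mul_pos (mul_pos f1 f2) f3) f4) f5) f6) f7) f8
  have hPCp : 0 < PC := by
    rw [hPC]
    have f1 : 0 < ((2 : ℝ) * e - d₀ - d₂) := by linarith
    have f2 : 0 < ((e : ℝ) + d₁ - d₀ - d₂) := by linarith
    have f3 : 0 < ((e : ℝ) - d₀) := by linarith
    have f4 : 0 < ((e : ℝ) + d₃ - d₀ - d₂) := by linarith
    have f5 : 0 < ((d₃ : ℝ) - d₂) := by linarith
    have f6 : 0 < ((d₁ : ℝ) - d₀) := by linarith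
    have f7 : 0 < ((d₁ : ℝ) + d₃ - d₀ - d₂) := by linarith
    have f8 : 0 < ((d₃ : ℝ) - d₀) := by linarith
    exact mul_pos (mul_pos (mul_pos (mul_pos (mul_pos (mul_pos (mul_pos f1 f2) f3) f4) f5) f6) f7) f8
  -- the three surviving coefficients
  obtain ⟨A, hA⟩ : ∃ x : ℝ, x = w₀ * w₁ * D01 * PA := ⟨_, rfl⟩
  obtain ⟨B, hB⟩ : ∃ x : ℝ, x = w₀ * (-m₀) * PB := ⟨_, rfl⟩
  obtain ⟨C, hC⟩ : ∃ x : ℝ, x = w₀ * w₂ * D02 * PC := ⟨_, rfl⟩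
  have hAp : 0 < A := by rw [hA]; exact mul_pos (mul_pos (mul_pos hw₀ hw₁) hD01) hPAp
  have hCp : 0 < C := by rw [hC]; exact mul_pos (mul_pos (mul_pos hw₀ hw₂) hD02) hPCp
  have hcirc' : B ^ (e - d₁ + (d₂ - e)) * ((((d₂ - e : ℕ) : ℝ)) ^ (d₂ - e) * (((e - d₁ : ℕ) : ℝ)) ^ (e - d₁)) < (((e - d₁ + (d₂ - e) : ℕ) : ℝ)) ^ (e - d₁ + (d₂ - e)) * (A ^ (d₂ - e) * C ^ (e - d₁)) := by
    rw [hA, hB, hC, hPA, hPB, hPC]; exact hcirc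
  clear hcirc
  -- eight kills
  have hkills := card_posRoots_le_kills (Finset.univ : Finset (Fin 11)) (![2 * e, e + d₀, e + d₁, e + d₂, e + d₃, d₀ + d₁, d₀ + d₂, d₀ + d₃, d₁ + d₂, d₁ + d₃, d₂ + d₃] : Fin 11 → ℕ) [2 * e, e + d₁, e + d₂, e + d₃, d₀ + d₃, d₁ + d₂, d₁ + d₃, d₂ + d₃] (![dJ, w₀ * m₀, w₁ * m₁, w₂ * m₂, w₃ * m₃, w₀ * w₁ * D01, w₀ * w₂ * D02, w₀ * w₃ * D03, w₁ * w₂ * D12, w₁ * w₃ * D13, w₂ * w₃ * D23] : Fin 11 → ℝ)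
  have htri : (∑ i ∈ (Finset.univ : Finset (Fin 11)), Polynomial.C ((![dJ, w₀ * m₀, w₁ * m₁, w₂ * m₂, w₃ * m₃, w₀ * w₁ * D01, w₀ * w₂ * D02, w₀ * w₃ * D03, w₁ * w₂ * D12, w₁ * w₃ * D13, w₂ * w₃ * D23] : Fin 11 → ℝ) i
          * (([2 * e, e + d₁, e + d₂, e + d₃, d₀ + d₃, d₁ + d₂, d₁ + d₃, d₂ + d₃]).map (fun ρ : ℕ => (((((![2 * e, e + d₀, e + d₁, e + d₂, e + d₃, d₀ + d₁, d₀ + d₂, d₀ + d₃, d₁ + d₂, d₁ + d₃, d₂ + d₃] : Fin 11 → ℕ)) i : ℕ) : ℝ) - (ρ : ℝ)))).prod) * X ^ ((![2 * e, e + d₀, e + d₁, e + d₂, e + d₃, d₀ + d₁, d₀ + d₂, d₀ + d₃, d₁ + d₂, d₁ + d₃, d₂ + d₃] : Fin 11 → ℕ) i))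
      = (Polynomial.C A * X ^ (d₀ + d₁) - Polynomial.C B * X ^ (d₀ + d₁ + (e - d₁)) + Polynomial.C C * X ^ (d₀ + d₁ + (e - d₁) + (d₂ - e))) := by
    have e1 : d₀ + d₁ + (e - d₁) = e + d₀ := by omega
    have e2 : d₀ + d₁ + (e - d₁) + (d₂ - e) = d₀ + d₂ := by omega
    rw [e2, e1]
    have hcoef : ∀ i : Fin 11, (![dJ, w₀ * m₀, w₁ * m₁, w₂ * m₂, w₃ * m₃, w₀ * w₁ * D01, w₀ * w₂ * D02, w₀ * w₃ * D03, w₁ * w₂ * D12, w₁ * w₃ * D13, w₂ * w₃ * D23] : Fin 11 → ℝ) i * (([2 * e, e + d₁, e + d₂, e + d₃, d₀ + d₃, d₁ + d₂, d₁ + d₃, d₂ + d₃]).map (fun ρ : ℕ => (((((![2 * e, e + d₀, e + d₁, e + d₂, e + d₃, d₀ + d₁, d₀ + d₂, d₀ + d₃, d₁ + d₂, d₁ + d₃, d₂ + d₃] : Fin 11 → ℕ)) i : ℕ) : ℝ) - (ρ : ℝ)))).prod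
        = (![0, -B, 0, 0, 0, A, C, 0, 0, 0, 0] : Fin 11 → ℝ) i := by
      intro i
      fin_cases i <;>
        simp only [Fin.zero_eta, Fin.mk_one, Fin.isValue, Matrix.cons_val_zero, Matrix.cons_val_one,
          List.map_cons, List.map_nil, List.prod_cons, List.prod_nil, hA, hB, hC, hPA, hPB, hPC] <;>
        push_cast <;> ring
    rw [Finset.sum_congr rfl (fun i _ => by rw [hcoef i])]
    simp only [Fin.sum_univ_succ, Fin.sum_univ_zero, Matrix.cons_val_zero, Matrix.cons_val_succ, map_zero, zero_mul,
      zero_add, add_zero, Polynomial.C_neg]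
    ring
  rw [htri] at hkills
  have hzero := card_posRoots_trinomial_eq_zero_of_circuit A B C (d₀ + d₁) (e - d₁) (d₂ - e) hAp hCp (by omega) (by omega) (Or.inr hcirc')
  simp only [List.length_cons, List.length_nil] at hkills
  omega

/-- **RANK-ONE `(2,4)₁` IN CHAMBER (B): `Z₊ ≤ 8` under (C₀)** (matrix form; `J` arbitrary, `w₀, w₁, w₂ > 0`, letters `0,1` and `0,2` not parallel). [this file] -/
theorem rankOne_posRoots_le_eight_of_C0 (e d₀ d₁ d₂ d₃ : ℕ) (h01 : d₀ < d₁) (h1e : d₁ < e) (he2 : e < d₂) (h23 : d₂ < d₃)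
    (hB1 : d₀ + d₂ < e + d₁)
    (J : Matrix (Fin 2) (Fin 2) ℝ) (v₀ v₁ v₂ v₃ : Fin 2 → ℝ) (w₀ w₁ w₂ w₃ : ℝ) (hw₀ : 0 < w₀) (hw₁ : 0 < w₁) (hw₂ : 0 < w₂) (hv01 : v₀ 0 * v₁ 1 - v₀ 1 * v₁ 0 ≠ 0) (hv02 : v₀ 0 * v₂ 1 - v₀ 1 * v₂ 0 ≠ 0)
    (hcirc : (w₀ * (-(J 0 0 * v₀ 1 ^ 2 + J 1 1 * v₀ 0 ^ 2 - (J 0 1 + J 1 0) * (v₀ 0 * v₀ 1)))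
        * (((e : ℝ) - d₀) * ((d₁ : ℝ) - d₀) * ((d₂ : ℝ) - d₀) * ((d₃ : ℝ) - d₀) * ((d₃ : ℝ) - e) * ((d₁ : ℝ) + d₂ - e - d₀) * ((d₁ : ℝ) + d₃ - e - d₀) * ((d₂ : ℝ) + d₃ - e - d₀))) ^ (e - d₁ + (d₂ - e)) * ((((d₂ - e : ℕ) : ℝ)) ^ (d₂ - e) * (((e - d₁ : ℕ) : ℝ)) ^ (e - d₁))
      < (((e - d₁ + (d₂ - e) : ℕ) : ℝ)) ^ (e - d₁ + (d₂ - e))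
        * ((w₀ * w₁ * ((v₀ 0 * v₁ 1 - v₀ 1 * v₁ 0) ^ 2)
          * (((2 : ℝ) * e - d₀ - d₁) * ((e : ℝ) - d₀) * ((e : ℝ) + d₂ - d₀ - d₁) * ((e : ℝ) + d₃ - d₀ - d₁) * ((d₃ : ℝ) - d₁) * ((d₂ : ℝ) - d₀) * ((d₃ : ℝ) - d₀) * ((d₂ : ℝ) + d₃ - d₀ - d₁))) ^ (d₂ - e)
          * (w₀ * w₂ * ((v₀ 0 * v₂ 1 - v₀ 1 * v₂ 0) ^ 2)
          * (((2 : ℝ) * e - d₀ - d₂) * ((e : ℝ) + d₁ - d₀ - d₂) * ((e : ℝ) - d₀) * ((e : ℝ) + d₃ - d₀ - d₂) * ((d₃ : ℝ) - d₂) * ((d₁ : ℝ) - d₀) * ((d₁ : ℝ) + d₃ - d₀ - d₂) * ((d₃ : ℝ) - d₀))) ^ (e - d₁))) :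
    ((Matrix.det (((X : ℝ[X]) ^ e) • J.map Polynomial.C
        + (Polynomial.C w₀ * X ^ d₀) • (vecMulVec v₀ v₀).map Polynomial.C
        + (Polynomial.C w₁ * X ^ d₁) • (vecMulVec v₁ v₁).map Polynomial.C
        + (Polynomial.C w₂ * X ^ d₂) • (vecMulVec v₂ v₂).map Polynomial.C
        + (Polynomial.C w₃ * X ^ d₃) • (vecMulVec v₃ v₃).map Polynomial.C)).roots.toFinset.filter (fun t => 0 < t)).card
      ≤ 8 := by
  rw [det_rankOne_four_sum]
  exact elevenNomial_chamberB_C0_le_eight e d₀ d₁ d₂ d₃ h01 h1e he2 h23 hB1 J.det _ _ _ _ w₀ w₁ w₂ w₃ _ _ _ _ _ _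
    hw₀ hw₁ hw₂ (by positivity) (by positivity) hcirc

/-! ## 2. (C₁): letter `1` weakly core -/

/-- **(C₁), real-parameter form.**  The chamber-(B) eleven-nomial (exponent hypotheses `d₀+d₂ < e+d₁`, `d₁+d₂ < 2e < d₀+d₃` beyond the split; all coefficient data
arbitrary except the positivity of the two surviving pair coefficients) has at most EIGHT positive roots when the killed negative term of
letter `1` is below the circuit number of its two killed neighbours. -/
theorem elevenNomial_chamberB_C1_le_eight (e d₀ d₁ d₂ d₃ : ℕ) (h01 : d₀ < d₁) (h1e : d₁ < e) (he2 : e < d₂) (h23 : d₂ < d₃)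
    (hB1 : d₀ + d₂ < e + d₁) (hB2 : d₁ + d₂ < 2 * e) (hB3 : 2 * e < d₀ + d₃)
    (dJ m₀ m₁ m₂ m₃ w₀ w₁ w₂ w₃ D01 D02 D03 D12 D13 D23 : ℝ) (hw₀ : 0 < w₀) (hw₁ : 0 < w₁) (hw₂ : 0 < w₂) (hD02 : 0 < D02) (hD12 : 0 < D12)
    (hcirc : (w₁ * (-m₁)
        * (((e : ℝ) - d₁) * ((d₁ : ℝ) - d₀) * ((d₂ : ℝ) - d₁) * ((d₃ : ℝ) - d₁) * ((e : ℝ) - d₀) * ((d₀ : ℝ) + d₃ - e - d₁) * ((d₃ : ℝ) - e) * ((d₂ : ℝ) + d₃ - e - d₁))) ^ ((e + d₁) - d₀ - d₂ + (d₂ - e)) * ((((d₂ - e : ℕ) : ℝ)) ^ (d₂ - e) * ((((e + d₁) - d₀ - d₂ : ℕ) : ℝ)) ^ ((e + d₁) - d₀ - d₂))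
      < ((((e + d₁) - d₀ - d₂ + (d₂ - e) : ℕ) : ℝ)) ^ ((e + d₁) - d₀ - d₂ + (d₂ - e))
        * ((w₀ * w₂ * D02
          * (((2 : ℝ) * e - d₀ - d₂) * ((d₂ : ℝ) - e) * ((e : ℝ) - d₀) * ((e : ℝ) + d₃ - d₀ - d₂) * ((d₂ : ℝ) - d₁) * ((d₃ : ℝ) - d₂) * ((d₁ : ℝ) + d₃ - d₀ - d₂) * ((d₃ : ℝ) - d₀))) ^ (d₂ - e)
          * (w₁ * w₂ * D12
          * (((2 : ℝ) * e - d₁ - d₂) * ((d₁ : ℝ) + d₂ - e - d₀) * ((e : ℝ) - d₁) * ((e : ℝ) + d₃ - d₁ - d₂) * ((d₂ : ℝ) - d₀) * ((d₀ : ℝ) + d₃ - d₁ - d₂) * ((d₃ : ℝ) - d₂) * ((d₃ : ℝ) - d₁))) ^ ((e + d₁) - d₀ - d₂))) :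
    ((∑ i : Fin 11, Polynomial.C ((![dJ, w₀ * m₀, w₁ * m₁, w₂ * m₂, w₃ * m₃, w₀ * w₁ * D01, w₀ * w₂ * D02, w₀ * w₃ * D03, w₁ * w₂ * D12, w₁ * w₃ * D13, w₂ * w₃ * D23] : Fin 11 → ℝ) i) * X ^ ((![2 * e, e + d₀, e + d₁, e + d₂, e + d₃, d₀ + d₁, d₀ + d₂, d₀ + d₃, d₁ + d₂, d₁ + d₃, d₂ + d₃] : Fin 11 → ℕ) i)).roots.toFinset.filter (fun t => 0 < t)).card ≤ 8 := by
  classical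
  have h01' : (d₀ : ℝ) < d₁ := by exact_mod_cast h01
  have h1e' : (d₁ : ℝ) < e := by exact_mod_cast h1e
  have he2' : (e : ℝ) < d₂ := by exact_mod_cast he2
  have h23' : (d₂ : ℝ) < d₃ := by exact_mod_cast h23
  have hB1' : (d₀ : ℝ) + d₂ < e + d₁ := by exact_mod_cast hB1
  have hB2' : (d₁ : ℝ) + d₂ < 2 * e := by exact_mod_cast hB2
  have hB3' : 2 * (e : ℝ) < d₀ + d₃ := by exact_mod_cast hB3
  -- the three distance products
  obtain ⟨PA, hPA⟩ : ∃ x : ℝ, x = ((2 : ℝ) * e - d₀ - d₂) * ((d₂ : ℝ) - e) * ((e : ℝ) - d₀) * ((e : ℝ) + d₃ - d₀ - d₂) * ((d₂ : ℝ) - d₁) * ((d₃ : ℝ) - d₂) * ((d₁ : ℝ) + d₃ - d₀ - d₂) * ((d₃ : ℝ) - d₀) := ⟨_, rfl⟩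
  obtain ⟨PB, hPB⟩ : ∃ x : ℝ, x = ((e : ℝ) - d₁) * ((d₁ : ℝ) - d₀) * ((d₂ : ℝ) - d₁) * ((d₃ : ℝ) - d₁) * ((e : ℝ) - d₀) * ((d₀ : ℝ) + d₃ - e - d₁) * ((d₃ : ℝ) - e) * ((d₂ : ℝ) + d₃ - e - d₁) := ⟨_, rfl⟩
  obtain ⟨PC, hPC⟩ : ∃ x : ℝ, x = ((2 : ℝ) * e - d₁ - d₂) * ((d₁ : ℝ) + d₂ - e - d₀) * ((e : ℝ) - d₁) * ((e : ℝ) + d₃ - d₁ - d₂) * ((d₂ : ℝ) - d₀) * ((d₀ : ℝ) + d₃ - d₁ - d₂) * ((d₃ : ℝ) - d₂) * ((d₃ : ℝ) - d₁) := ⟨_, rfl⟩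
  have hPAp : 0 < PA := by
    rw [hPA]
    have f1 : 0 < ((2 : ℝ) * e - d₀ - d₂) := by linarith
    have f2 : 0 < ((d₂ : ℝ) - e) := by linarith
    have f3 : 0 < ((e : ℝ) - d₀) := by linarith
    have f4 : 0 < ((e : ℝ) + d₃ - d₀ - d₂) := by linarith
    have f5 : 0 < ((d₂ : ℝ) - d₁) := by linarith
    have f6 : 0 < ((d₃ : ℝ) - d₂) := by linarith
    have f7 : 0 < ((d₁ : ℝ) + d₃ - d₀ - d₂) := by linarith
    have f8 : 0 < ((d₃ : ℝ) - d₀) := by linarith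
    exact mul_pos (mul_pos (mul_pos (mul_pos (mul_pos (mul_pos (mul_pos f1 f2) f3) f4) f5) f6) f7) f8
  have hPCp : 0 < PC := by
    rw [hPC]
    have f1 : 0 < ((2 : ℝ) * e - d₁ - d₂) := by linarith
    have f2 : 0 < ((d₁ : ℝ) + d₂ - e - d₀) := by linarith
    have f3 : 0 < ((e : ℝ) - d₁) := by linarith
    have f4 : 0 < ((e : ℝ) + d₃ - d₁ - d₂) := by linarith
    have f5 : 0 < ((d₂ : ℝ) - d₀) := by linarith
    have f6 : 0 < ((d₀ : ℝ) + d₃ - d₁ - d₂) := by linarith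
    have f7 : 0 < ((d₃ : ℝ) - d₂) := by linarith
    have f8 : 0 < ((d₃ : ℝ) - d₁) := by linarith
    exact mul_pos (mul_pos (mul_pos (mul_pos (mul_pos (mul_pos (mul_pos f1 f2) f3) f4) f5) f6) f7) f8
  -- the three surviving coefficients
  obtain ⟨A, hA⟩ : ∃ x : ℝ, x = w₀ * w₂ * D02 * PA := ⟨_, rfl⟩
  obtain ⟨B, hB⟩ : ∃ x : ℝ, x = w₁ * (-m₁) * PB := ⟨_, rfl⟩
  obtain ⟨C, hC⟩ : ∃ x : ℝ, x = w₁ * w₂ * D12 * PC := ⟨_, rfl⟩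
  have hAp : 0 < A := by rw [hA]; exact mul_pos (mul_pos (mul_pos hw₀ hw₂) hD02) hPAp
  have hCp : 0 < C := by rw [hC]; exact mul_pos (mul_pos (mul_pos hw₁ hw₂) hD12) hPCp
  have hcirc' : B ^ ((e + d₁) - d₀ - d₂ + (d₂ - e)) * ((((d₂ - e : ℕ) : ℝ)) ^ (d₂ - e) * ((((e + d₁) - d₀ - d₂ : ℕ) : ℝ)) ^ ((e + d₁) - d₀ - d₂)) < ((((e + d₁) - d₀ - d₂ + (d₂ - e) : ℕ) : ℝ)) ^ ((e + d₁) - d₀ - d₂ + (d₂ - e)) * (A ^ (d₂ - e) * C ^ ((e + d₁) - d₀ - d₂)) := by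
    rw [hA, hB, hC, hPA, hPB, hPC]; exact hcirc
  clear hcirc
  -- eight kills
  have hkills := card_posRoots_le_kills (Finset.univ : Finset (Fin 11)) (![2 * e, e + d₀, e + d₁, e + d₂, e + d₃, d₀ + d₁, d₀ + d₂, d₀ + d₃, d₁ + d₂, d₁ + d₃, d₂ + d₃] : Fin 11 → ℕ) [2 * e, e + d₀, e + d₂, e + d₃, d₀ + d₁, d₀ + d₃, d₁ + d₃, d₂ + d₃] (![dJ, w₀ * m₀, w₁ * m₁, w₂ * m₂, w₃ * m₃, w₀ * w₁ * D01, w₀ * w₂ * D02, w₀ * w₃ * D03, w₁ * w₂ * D12, w₁ * w₃ * D13, w₂ * w₃ * D23] : Fin 11 → ℝ)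
  have htri : (∑ i ∈ (Finset.univ : Finset (Fin 11)), Polynomial.C ((![dJ, w₀ * m₀, w₁ * m₁, w₂ * m₂, w₃ * m₃, w₀ * w₁ * D01, w₀ * w₂ * D02, w₀ * w₃ * D03, w₁ * w₂ * D12, w₁ * w₃ * D13, w₂ * w₃ * D23] : Fin 11 → ℝ) i
          * (([2 * e, e + d₀, e + d₂, e + d₃, d₀ + d₁, d₀ + d₃, d₁ + d₃, d₂ + d₃]).map (fun ρ : ℕ => (((((![2 * e, e + d₀, e + d₁, e + d₂, e + d₃, d₀ + d₁, d₀ + d₂, d₀ + d₃, d₁ + d₂, d₁ + d₃, d₂ + d₃] : Fin 11 → ℕ)) i : ℕ) : ℝ) - (ρ : ℝ)))).prod) * X ^ ((![2 * e, e + d₀, e + d₁, e + d₂, e + d₃, d₀ + d₁, d₀ + d₂, d₀ + d₃, d₁ + d₂, d₁ + d₃, d₂ + d₃] : Fin 11 → ℕ) i))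
      = (Polynomial.C A * X ^ (d₀ + d₂) - Polynomial.C B * X ^ (d₀ + d₂ + ((e + d₁) - d₀ - d₂)) + Polynomial.C C * X ^ (d₀ + d₂ + ((e + d₁) - d₀ - d₂) + (d₂ - e))) := by
    have e1 : d₀ + d₂ + ((e + d₁) - d₀ - d₂) = e + d₁ := by omega
    have e2 : d₀ + d₂ + ((e + d₁) - d₀ - d₂) + (d₂ - e) = d₁ + d₂ := by omega
    rw [e2, e1]
    have hcoef : ∀ i : Fin 11, (![dJ, w₀ * m₀, w₁ * m₁, w₂ * m₂, w₃ * m₃, w₀ * w₁ * D01, w₀ * w₂ * D02, w₀ * w₃ * D03, w₁ * w₂ * D12, w₁ * w₃ * D13, w₂ * w₃ * D23] : Fin 11 → ℝ) i * (([2 * e, e + d₀, e + d₂, e + d₃, d₀ + d₁, d₀ + d₃, d₁ + d₃, d₂ + d₃]).map (fun ρ : ℕ => (((((![2 * e, e + d₀, e + d₁, e + d₂, e + d₃, d₀ + d₁, d₀ + d₂, d₀ + d₃, d₁ + d₂, d₁ + d₃, d₂ + d₃] : Fin 11 → ℕ)) i : ℕ) : ℝ) - (ρ : ℝ)))).pr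od
        = (![0, 0, -B, 0, 0, 0, A, 0, C, 0, 0] : Fin 11 → ℝ) i := by
      intro i
      fin_cases i <;>
        simp only [Fin.zero_eta, Fin.mk_one, Fin.isValue, Matrix.cons_val_zero, Matrix.cons_val_one,
          List.map_cons, List.map_nil, List.prod_cons, List.prod_nil, hA, hB, hC, hPA, hPB, hPC] <;>
        push_cast <;> ring
    rw [Finset.sum_congr rfl (fun i _ => by rw [hcoef i])]
    simp only [Fin.sum_univ_succ, Fin.sum_univ_zero, Matrix.cons_val_zero, Matrix.cons_val_succ, map_zero, zero_mul,
      zero_add, add_zero, Polynomial.C_neg]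
    ring
  rw [htri] at hkills
  have hzero := card_posRoots_trinomial_eq_zero_of_circuit A B C (d₀ + d₂) ((e + d₁) - d₀ - d₂) (d₂ - e) hAp hCp (by omega) (by omega) (Or.inr hcirc')
  simp only [List.length_cons, List.length_nil] at hkills
  omega

/-- **RANK-ONE `(2,4)₁` IN CHAMBER (B): `Z₊ ≤ 8` under (C₁)** (matrix form; `J` arbitrary, `w₀, w₁, w₂ > 0`, letters `0,2` and `1,2` not parallel). [this file] -/
theorem rankOne_posRoots_le_eight_of_C1 (e d₀ d₁ d₂ d₃ : ℕ) (h01 : d₀ < d₁) (h1e : d₁ < e) (he2 : e < d₂) (h23 : d₂ < d₃)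
    (hB1 : d₀ + d₂ < e + d₁) (hB2 : d₁ + d₂ < 2 * e) (hB3 : 2 * e < d₀ + d₃)
    (J : Matrix (Fin 2) (Fin 2) ℝ) (v₀ v₁ v₂ v₃ : Fin 2 → ℝ) (w₀ w₁ w₂ w₃ : ℝ) (hw₀ : 0 < w₀) (hw₁ : 0 < w₁) (hw₂ : 0 < w₂) (hv02 : v₀ 0 * v₂ 1 - v₀ 1 * v₂ 0 ≠ 0) (hv12 : v₁ 0 * v₂ 1 - v₁ 1 * v₂ 0 ≠ 0)
    (hcirc : (w₁ * (-(J 0 0 * v₁ 1 ^ 2 + J 1 1 * v₁ 0 ^ 2 - (J 0 1 + J 1 0) * (v₁ 0 * v₁ 1)))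
        * (((e : ℝ) - d₁) * ((d₁ : ℝ) - d₀) * ((d₂ : ℝ) - d₁) * ((d₃ : ℝ) - d₁) * ((e : ℝ) - d₀) * ((d₀ : ℝ) + d₃ - e - d₁) * ((d₃ : ℝ) - e) * ((d₂ : ℝ) + d₃ - e - d₁))) ^ ((e + d₁) - d₀ - d₂ + (d₂ - e)) * ((((d₂ - e : ℕ) : ℝ)) ^ (d₂ - e) * ((((e + d₁) - d₀ - d₂ : ℕ) : ℝ)) ^ ((e + d₁) - d₀ - d₂))
      < ((((e + d₁) - d₀ - d₂ + (d₂ - e) : ℕ) : ℝ)) ^ ((e + d₁) - d₀ - d₂ + (d₂ - e))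
        * ((w₀ * w₂ * ((v₀ 0 * v₂ 1 - v₀ 1 * v₂ 0) ^ 2)
          * (((2 : ℝ) * e - d₀ - d₂) * ((d₂ : ℝ) - e) * ((e : ℝ) - d₀) * ((e : ℝ) + d₃ - d₀ - d₂) * ((d₂ : ℝ) - d₁) * ((d₃ : ℝ) - d₂) * ((d₁ : ℝ) + d₃ - d₀ - d₂) * ((d₃ : ℝ) - d₀))) ^ (d₂ - e)
          * (w₁ * w₂ * ((v₁ 0 * v₂ 1 - v₁ 1 * v₂ 0) ^ 2)
          * (((2 : ℝ) * e - d₁ - d₂) * ((d₁ : ℝ) + d₂ - e - d₀) * ((e : ℝ) - d₁) * ((e : ℝ) + d₃ - d₁ - d₂) * ((d₂ : ℝ) - d₀) * ((d₀ : ℝ) + d₃ - d₁ - d₂) * ((d₃ : ℝ) - d₂) * ((d₃ : ℝ) - d₁))) ^ ((e + d₁) - d₀ - d₂))) :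
    ((Matrix.det (((X : ℝ[X]) ^ e) • J.map Polynomial.C
        + (Polynomial.C w₀ * X ^ d₀) • (vecMulVec v₀ v₀).map Polynomial.C
        + (Polynomial.C w₁ * X ^ d₁) • (vecMulVec v₁ v₁).map Polynomial.C
        + (Polynomial.C w₂ * X ^ d₂) • (vecMulVec v₂ v₂).map Polynomial.C
        + (Polynomial.C w₃ * X ^ d₃) • (vecMulVec v₃ v₃).map Polynomial.C)).roots.toFinset.filter (fun t => 0 < t)).card
      ≤ 8 := by
  rw [det_rankOne_four_sum]
  exact elevenNomial_chamberB_C1_le_eight e d₀ d₁ d₂ d₃ h01 h1e he2 h23 hB1 hB2 hB3 J.det _ _ _ _ w₀ w₁ w₂ w₃ _ _ _ _ _ _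
    hw₀ hw₁ hw₂ (by positivity) (by positivity) hcirc

/-! ## 3. (C_J): the pivot weakly indefinite -/

/-- **(C_J), real-parameter form.**  The chamber-(B) eleven-nomial (exponent hypotheses `d₁+d₂ < 2e < d₀+d₃ < e+d₂` beyond the split; all coefficient data
arbitrary except the positivity of the two surviving pair coefficients) has at most EIGHT positive roots when the killed negative term of
the pivot (`β = |det J|·Π`) is below the circuit number of its two killed neighbours. -/
theorem elevenNomial_chamberB_CJ_le_eight (e d₀ d₁ d₂ d₃ : ℕ) (h01 : d₀ < d₁) (h1e : d₁ < e) (he2 : e < d₂) (h23 : d₂ < d₃)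
    (hB2 : d₁ + d₂ < 2 * e) (hB3 : 2 * e < d₀ + d₃) (hB4 : d₀ + d₃ < e + d₂)
    (dJ m₀ m₁ m₂ m₃ w₀ w₁ w₂ w₃ D01 D02 D03 D12 D13 D23 : ℝ) (hw₀ : 0 < w₀) (hw₁ : 0 < w₁) (hw₂ : 0 < w₂) (hw₃ : 0 < w₃) (hD03 : 0 < D03) (hD12 : 0 < D12)
    (hcirc : ((-dJ)
        * (((e : ℝ) - d₀) * ((e : ℝ) - d₁) * ((d₂ : ℝ) - e) * ((d₃ : ℝ) - e) * ((2 : ℝ) * e - d₀ - d₁) * ((2 : ℝ) * e - d₀ - d₂) * ((d₁ : ℝ) + d₃ - 2 * e) * ((d₂ : ℝ) + d₃ - 2 * e))) ^ (2 * e - d₁ - d₂ + ((d₀ + d₃) - 2 * e)) * (((((d₀ + d₃) - 2 * e : ℕ) : ℝ)) ^ ((d₀ + d₃) - 2 * e) * (((2 * e - d₁ - d₂ : ℕ) : ℝ)) ^ (2 * e - d₁ - d₂))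
      < (((2 * e - d₁ - d₂ + ((d₀ + d₃) - 2 * e) : ℕ) : ℝ)) ^ (2 * e - d₁ - d₂ + ((d₀ + d₃) - 2 * e))
        * ((w₁ * w₂ * D12
          * (((d₁ : ℝ) + d₂ - e - d₀) * ((d₂ : ℝ) - e) * ((e : ℝ) - d₁) * ((e : ℝ) + d₃ - d₁ - d₂) * ((d₂ : ℝ) - d₀) * ((d₁ : ℝ) - d₀) * ((d₃ : ℝ) - d₂) * ((d₃ : ℝ) - d₁))) ^ ((d₀ + d₃) - 2 * e)
          * (w₀ * w₃ * D03
          * (((d₃ : ℝ) - e) * ((d₀ : ℝ) + d₃ - e - d₁) * ((e : ℝ) + d₂ - d₀ - d₃) * ((e : ℝ) - d₀) * ((d₃ : ℝ) - d₁) * ((d₃ : ℝ) - d₂) * ((d₁ : ℝ) - d₀) * ((d₂ : ℝ) - d₀))) ^ (2 * e - d₁ - d₂))) :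
    ((∑ i : Fin 11, Polynomial.C ((![dJ, w₀ * m₀, w₁ * m₁, w₂ * m₂, w₃ * m₃, w₀ * w₁ * D01, w₀ * w₂ * D02, w₀ * w₃ * D03, w₁ * w₂ * D12, w₁ * w₃ * D13, w₂ * w₃ * D23] : Fin 11 → ℝ) i) * X ^ ((![2 * e, e + d₀, e + d₁, e + d₂, e + d₃, d₀ + d₁, d₀ + d₂, d₀ + d₃, d₁ + d₂, d₁ + d₃, d₂ + d₃] : Fin 11 → ℕ) i)).roots.toFinset.filter (fun t => 0 < t)).card ≤ 8 := by
  classical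
  have h01' : (d₀ : ℝ) < d₁ := by exact_mod_cast h01
  have h1e' : (d₁ : ℝ) < e := by exact_mod_cast h1e
  have he2' : (e : ℝ) < d₂ := by exact_mod_cast he2
  have h23' : (d₂ : ℝ) < d₃ := by exact_mod_cast h23
  have hB2' : (d₁ : ℝ) + d₂ < 2 * e := by exact_mod_cast hB2
  have hB3' : 2 * (e : ℝ) < d₀ + d₃ := by exact_mod_cast hB3
  have hB4' : (d₀ : ℝ) + d₃ < e + d₂ := by exact_mod_cast hB4
  -- the three distance products
  obtain ⟨PA, hPA⟩ : ∃ x : ℝ, x = ((d₁ : ℝ) + d₂ - e - d₀) * ((d₂ : ℝ) - e) * ((e : ℝ) - d₁) * ((e : ℝ) + d₃ - d₁ - d₂) * ((d₂ : ℝ) - d₀) * ((d₁ : ℝ) - d₀) * ((d₃ : ℝ) - d₂) * ((d₃ : ℝ) - d₁) := ⟨_, rfl⟩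
  obtain ⟨PB, hPB⟩ : ∃ x : ℝ, x = ((e : ℝ) - d₀) * ((e : ℝ) - d₁) * ((d₂ : ℝ) - e) * ((d₃ : ℝ) - e) * ((2 : ℝ) * e - d₀ - d₁) * ((2 : ℝ) * e - d₀ - d₂) * ((d₁ : ℝ) + d₃ - 2 * e) * ((d₂ : ℝ) + d₃ - 2 * e) := ⟨_, rfl⟩
  obtain ⟨PC, hPC⟩ : ∃ x : ℝ, x = ((d₃ : ℝ) - e) * ((d₀ : ℝ) + d₃ - e - d₁) * ((e : ℝ) + d₂ - d₀ - d₃) * ((e : ℝ) - d₀) * ((d₃ : ℝ) - d₁) * ((d₃ : ℝ) - d₂) * ((d₁ : ℝ) - d₀) * ((d₂ : ℝ) - d₀) := ⟨_, rfl⟩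
  have hPAp : 0 < PA := by
    rw [hPA]
    have f1 : 0 < ((d₁ : ℝ) + d₂ - e - d₀) := by linarith
    have f2 : 0 < ((d₂ : ℝ) - e) := by linarith
    have f3 : 0 < ((e : ℝ) - d₁) := by linarith
    have f4 : 0 < ((e : ℝ) + d₃ - d₁ - d₂) := by linarith
    have f5 : 0 < ((d₂ : ℝ) - d₀) := by linarith
    have f6 : 0 < ((d₁ : ℝ) - d₀) := by linarith
    have f7 : 0 < ((d₃ : ℝ) - d₂) := by linarith
    have f8 : 0 < ((d₃ : ℝ) - d₁) := by linarith
    exact mul_pos (mul_pos (mul_pos (mul_pos (mul_pos (mul_pos (mul_pos f1 f2) f3) f4) f5) f6) f7) f8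
  have hPCp : 0 < PC := by
    rw [hPC]
    have f1 : 0 < ((d₃ : ℝ) - e) := by linarith
    have f2 : 0 < ((d₀ : ℝ) + d₃ - e - d₁) := by linarith
    have f3 : 0 < ((e : ℝ) + d₂ - d₀ - d₃) := by linarith
    have f4 : 0 < ((e : ℝ) - d₀) := by linarith
    have f5 : 0 < ((d₃ : ℝ) - d₁) := by linarith
    have f6 : 0 < ((d₃ : ℝ) - d₂) := by linarith
    have f7 : 0 < ((d₁ : ℝ) - d₀) := by linarith
    have f8 : 0 < ((d₂ : ℝ) - d₀) := by linarith
    exact mul_pos (mul_pos (mul_pos (mul_pos (mul_pos (mul_pos (mul_pos f1 f2) f3) f4) f5) f6) f7) f8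
  -- the three surviving coefficients
  obtain ⟨A, hA⟩ : ∃ x : ℝ, x = w₁ * w₂ * D12 * PA := ⟨_, rfl⟩
  obtain ⟨B, hB⟩ : ∃ x : ℝ, x = (-dJ) * PB := ⟨_, rfl⟩
  obtain ⟨C, hC⟩ : ∃ x : ℝ, x = w₀ * w₃ * D03 * PC := ⟨_, rfl⟩
  have hAp : 0 < A := by rw [hA]; exact mul_pos (mul_pos (mul_pos hw₁ hw₂) hD12) hPAp
  have hCp : 0 < C := by rw [hC]; exact mul_pos (mul_pos (mul_pos hw₀ hw₃) hD03) hPCp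
  have hcirc' : B ^ (2 * e - d₁ - d₂ + ((d₀ + d₃) - 2 * e)) * (((((d₀ + d₃) - 2 * e : ℕ) : ℝ)) ^ ((d₀ + d₃) - 2 * e) * (((2 * e - d₁ - d₂ : ℕ) : ℝ)) ^ (2 * e - d₁ - d₂)) < (((2 * e - d₁ - d₂ + ((d₀ + d₃) - 2 * e) : ℕ) : ℝ)) ^ (2 * e - d₁ - d₂ + ((d₀ + d₃) - 2 * e)) * (A ^ ((d₀ + d₃) - 2 * e) * C ^ (2 * e - d₁ - d₂)) := by
    rw [hA, hB, hC, hPA, hPB, hPC]; exact hcirc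
  clear hcirc
  -- eight kills
  have hkills := card_posRoots_le_kills (Finset.univ : Finset (Fin 11)) (![2 * e, e + d₀, e + d₁, e + d₂, e + d₃, d₀ + d₁, d₀ + d₂, d₀ + d₃, d₁ + d₂, d₁ + d₃, d₂ + d₃] : Fin 11 → ℕ) [e + d₀, e + d₁, e + d₂, e + d₃, d₀ + d₁, d₀ + d₂, d₁ + d₃, d₂ + d₃] (![dJ, w₀ * m₀, w₁ * m₁, w₂ * m₂, w₃ * m₃, w₀ * w₁ * D01, w₀ * w₂ * D02, w₀ * w₃ * D03, w₁ * w₂ * D12, w₁ * w₃ * D13, w₂ * w₃ * D23] : Fin 11 → ℝ)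
  have htri : (∑ i ∈ (Finset.univ : Finset (Fin 11)), Polynomial.C ((![dJ, w₀ * m₀, w₁ * m₁, w₂ * m₂, w₃ * m₃, w₀ * w₁ * D01, w₀ * w₂ * D02, w₀ * w₃ * D03, w₁ * w₂ * D12, w₁ * w₃ * D13, w₂ * w₃ * D23] : Fin 11 → ℝ) i
          * (([e + d₀, e + d₁, e + d₂, e + d₃, d₀ + d₁, d₀ + d₂, d₁ + d₃, d₂ + d₃]).map (fun ρ : ℕ => (((((![2 * e, e + d₀, e + d₁, e + d₂, e + d₃, d₀ + d₁, d₀ + d₂, d₀ + d₃, d₁ + d₂, d₁ + d₃, d₂ + d₃] : Fin 11 → ℕ)) i : ℕ) : ℝ) - (ρ : ℝ)))).prod) * X ^ ((![2 * e, e + d₀, e + d₁, e + d₂, e + d₃, d₀ + d₁, d₀ + d₂, d₀ + d₃, d₁ + d₂, d₁ + d₃, d₂ + d₃] : Fin 11 → ℕ) i))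
      = (Polynomial.C A * X ^ (d₁ + d₂) - Polynomial.C B * X ^ (d₁ + d₂ + (2 * e - d₁ - d₂)) + Polynomial.C C * X ^ (d₁ + d₂ + (2 * e - d₁ - d₂) + ((d₀ + d₃) - 2 * e))) := by
    have e1 : d₁ + d₂ + (2 * e - d₁ - d₂) = 2 * e := by omega
    have e2 : d₁ + d₂ + (2 * e - d₁ - d₂) + ((d₀ + d₃) - 2 * e) = d₀ + d₃ := by omega
    rw [e2, e1]
    have hcoef : ∀ i : Fin 11, (![dJ, w₀ * m₀, w₁ * m₁, w₂ * m₂, w₃ * m₃, w₀ * w₁ * D01, w₀ * w₂ * D02, w₀ * w₃ * D03, w₁ * w₂ * D12, w₁ * w₃ * D13, w₂ * w₃ * D23] : Fin 11 → ℝ) i * (([e + d₀, e + d₁, e + d₂, e + d₃, d₀ + d₁, d₀ + d₂, d₁ + d₃, d₂ + d₃]).map (fun ρ : ℕ => (((((![2 * e, e + d₀, e + d₁, e + d₂, e + d₃, d₀ + d₁, d₀ + d₂, d₀ + d₃, d₁ + d₂, d₁ + d₃, d₂ + d₃] : Fin 11 → ℕ)) i : ℕ) : ℝ) - (ρ : 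ℝ)))).prod
        = (![-B, 0, 0, 0, 0, 0, 0, C, A, 0, 0] : Fin 11 → ℝ) i := by
      intro i
      fin_cases i <;>
        simp only [Fin.zero_eta, Fin.mk_one, Fin.isValue, Matrix.cons_val_zero, Matrix.cons_val_one,
          List.map_cons, List.map_nil, List.prod_cons, List.prod_nil, hA, hB, hC, hPA, hPB, hPC] <;>
        push_cast <;> ring
    rw [Finset.sum_congr rfl (fun i _ => by rw [hcoef i])]
    simp only [Fin.sum_univ_succ, Fin.sum_univ_zero, Matrix.cons_val_zero, Matrix.cons_val_succ, map_zero, zero_mul,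
      zero_add, add_zero, Polynomial.C_neg]
    ring
  rw [htri] at hkills
  have hzero := card_posRoots_trinomial_eq_zero_of_circuit A B C (d₁ + d₂) (2 * e - d₁ - d₂) ((d₀ + d₃) - 2 * e) hAp hCp (by omega) (by omega) (Or.inr hcirc')
  simp only [List.length_cons, List.length_nil] at hkills
  omega

/-- **RANK-ONE `(2,4)₁` IN CHAMBER (B): `Z₊ ≤ 8` under (C_J)** (matrix form; `J` arbitrary, `w₀, w₁, w₂, w₃ > 0`, letters `1,2` and `0,3` not parallel). [this file] -/
theorem rankOne_posRoots_le_eight_of_CJ (e d₀ d₁ d₂ d₃ : ℕ) (h01 : d₀ < d₁) (h1e : d₁ < e) (he2 : e < d₂) (h23 : d₂ < d₃)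
    (hB2 : d₁ + d₂ < 2 * e) (hB3 : 2 * e < d₀ + d₃) (hB4 : d₀ + d₃ < e + d₂)
    (J : Matrix (Fin 2) (Fin 2) ℝ) (v₀ v₁ v₂ v₃ : Fin 2 → ℝ) (w₀ w₁ w₂ w₃ : ℝ) (hw₀ : 0 < w₀) (hw₁ : 0 < w₁) (hw₂ : 0 < w₂) (hw₃ : 0 < w₃) (hv03 : v₀ 0 * v₃ 1 - v₀ 1 * v₃ 0 ≠ 0) (hv12 : v₁ 0 * v₂ 1 - v₁ 1 * v₂ 0 ≠ 0)
    (hcirc : ((-J.det)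
        * (((e : ℝ) - d₀) * ((e : ℝ) - d₁) * ((d₂ : ℝ) - e) * ((d₃ : ℝ) - e) * ((2 : ℝ) * e - d₀ - d₁) * ((2 : ℝ) * e - d₀ - d₂) * ((d₁ : ℝ) + d₃ - 2 * e) * ((d₂ : ℝ) + d₃ - 2 * e))) ^ (2 * e - d₁ - d₂ + ((d₀ + d₃) - 2 * e)) * (((((d₀ + d₃) - 2 * e : ℕ) : ℝ)) ^ ((d₀ + d₃) - 2 * e) * (((2 * e - d₁ - d₂ : ℕ) : ℝ)) ^ (2 * e - d₁ - d₂))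
      < (((2 * e - d₁ - d₂ + ((d₀ + d₃) - 2 * e) : ℕ) : ℝ)) ^ (2 * e - d₁ - d₂ + ((d₀ + d₃) - 2 * e))
        * ((w₁ * w₂ * ((v₁ 0 * v₂ 1 - v₁ 1 * v₂ 0) ^ 2)
          * (((d₁ : ℝ) + d₂ - e - d₀) * ((d₂ : ℝ) - e) * ((e : ℝ) - d₁) * ((e : ℝ) + d₃ - d₁ - d₂) * ((d₂ : ℝ) - d₀) * ((d₁ : ℝ) - d₀) * ((d₃ : ℝ) - d₂) * ((d₃ : ℝ) - d₁))) ^ ((d₀ + d₃) - 2 * e)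
          * (w₀ * w₃ * ((v₀ 0 * v₃ 1 - v₀ 1 * v₃ 0) ^ 2)
          * (((d₃ : ℝ) - e) * ((d₀ : ℝ) + d₃ - e - d₁) * ((e : ℝ) + d₂ - d₀ - d₃) * ((e : ℝ) - d₀) * ((d₃ : ℝ) - d₁) * ((d₃ : ℝ) - d₂) * ((d₁ : ℝ) - d₀) * ((d₂ : ℝ) - d₀))) ^ (2 * e - d₁ - d₂))) :
    ((Matrix.det (((X : ℝ[X]) ^ e) • J.map Polynomial.C
        + (Polynomial.C w₀ * X ^ d₀) • (vecMulVec v₀ v₀).map Polynomial.C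
        + (Polynomial.C w₁ * X ^ d₁) • (vecMulVec v₁ v₁).map Polynomial.C
        + (Polynomial.C w₂ * X ^ d₂) • (vecMulVec v₂ v₂).map Polynomial.C
        + (Polynomial.C w₃ * X ^ d₃) • (vecMulVec v₃ v₃).map Polynomial.C)).roots.toFinset.filter (fun t => 0 < t)).card
      ≤ 8 := by
  rw [det_rankOne_four_sum]
  exact elevenNomial_chamberB_CJ_le_eight e d₀ d₁ d₂ d₃ h01 h1e he2 h23 hB2 hB3 hB4 J.det _ _ _ _ w₀ w₁ w₂ w₃ _ _ _ _ _ _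
    hw₀ hw₁ hw₂ hw₃ (by positivity) (by positivity) hcirc

end Summit.ValiantsHypothesis.ValiantsHypothesis.Theorems.LacunarySymmetroidMatrixDescartes.Pivot.TwoDirections.BlockLaw
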